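import Summits.AtomisticToContinuum.Crystallization.Theorems.ReggeStarCoercivityDefectFreeCrystallizesDevelopmentSteps1
import Summits.AtomisticToContinuum.Crystallization.Theorems.ReggeStarCoercivityDefectFreeCrystallizesDevelopmentSteps2
import Summits.AtomisticToContinuum.Crystallization.Theorems.ReggeStarCoercivityDefectFreeCrystallizesDevelopmentSteps3
import Summits.AtomisticToContinuum.Crystallization.Theorems.ReggeStarCoercivityDefectFreeCrystallizesDevelopmentSteps6
import Summits.AtomisticToContinuum.Crystallization.Theorems.ReggeStarCoercivityDefectFreeCrystallizesDevelopmentSteps7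
import Summits.AtomisticToContinuum.Crystallization.Theorems.ReggeStarCoercivityDefectFreeCrystallizesDevelopmentVinv
import Summits.AtomisticToContinuum.Crystallization.Theorems.ReggeStarCoercivityDefectFreeCrystallizesDevelopmentAttach1
import Summits.AtomisticToContinuum.Crystallization.Theorems.ReggeStarCoercivityDefectFreeCrystallizesDevelopmentAttach2
import Summits.AtomisticToContinuum.Crystallization.Theorems.ReggeStarCoercivityDefectFreeCrystallizesDevelopmentComm1
import Summits.AtomisticToContinuum.Crystallization.Theorems.ReggeStarCoercivityDefectFreeCrystallizesDevelopmentVComm1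
import Summits.AtomisticToContinuum.Crystallization.Theorems.ReggeStarCoercivityDefectFreeCrystallizesDevelopmentGlobalA
import Summits.AtomisticToContinuum.Crystallization.Theorems.ReggeStarCoercivityDefectFreeCrystallizesDevelopmentGlobalD
import Summits.AtomisticToContinuum.Crystallization.Theorems.PalmUnimodularRigidityShellsToBarlowChartTransportGlobalE

/-!
# The neighbour sites of a frame of the development (port to the abstract `1/20` chart clauses)

Port of `Theorems/PalmUnimodularRigidityShellsToBarlowChartTransportGlobalE.lean` (crux 9227, line
`develop-the-model-growth-descent`) to the ABSTRACT chart clauses of line `palm-good-law` of crux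
stmt-AtomisticToContinuum-13603 (stub R1a4 `stub_combinatorialDevelopment`): the integer-chart hypothesis
`hch : ∀ z ∈ S, IsZChart S z …` is replaced by the section hypothesis `hch` = (pattern `fcc3Int`/`hcpInt`,
labelling `nb z` bijective onto the bonded neighbours, exact links) at every site ∧ the transfer identity for
every bonded pair; statements and proofs are otherwise verbatim (the transports `Istep, …, frameAt` and the
pattern facts `TransportPatterns*` are reused by name).  All `[folklore]` (HalesDSP2012 §1.3).
-/

noncomputable section

namespace Summit.AtomisticToContinuum.Crystallization.Theorems.PalmGoodLaw.Development

open Literature.Geometry.DiscreteGeometry Literature.MathematicalPhysics.StatisticalMechanics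
open Summit.AtomisticToContinuum.Crystallization.Theorems.ShellsToBarlowChartNegative
open Summit.AtomisticToContinuum.Crystallization.Theorems.PalmUnimodularRigidityShellsToBarlowChart

variable {S : Set (EuclideanSpace ℝ (Fin 3))} {Pc : (EuclideanSpace ℝ (Fin 3)) → Finset (Fin 3 → ℤ)}
  {nb : (EuclideanSpace ℝ (Fin 3)) → (Fin 3 → ℤ) → (EuclideanSpace ℝ (Fin 3))}
  (hch : (∀ z ∈ S, (Pc z = fcc3Int ∨ Pc z = hcpInt) ∧
      Set.BijOn (nb z) (↑(Pc z) : Set (Fin 3 → ℤ)) {y | y ∈ S ∧ (0 < dist z y ∧ dist z y ≤ 28 / 25)} ∧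
      (∀ t ∈ Pc z, ∀ t' ∈ Pc z,
        ((0 < dist (nb z t) (nb z t') ∧ dist (nb z t) (nb z t') ≤ 28 / 25) ↔ sqNormInt (t - t') = 18))) ∧
    (∀ x ∈ S, ∀ y ∈ S, (0 < dist x y ∧ dist x y ≤ 28 / 25) →
      ∀ (z z' : EuclideanSpace ℝ (Fin 3)) (t t' u u' : Fin 3 → ℤ),
        ((t = 0 ∧ z = x) ∨ (t ∈ Pc x ∧ z = nb x t)) → ((t' = 0 ∧ z' = x) ∨ (t' ∈ Pc x ∧ z' = nb x t')) →
        ((u = 0 ∧ z = y) ∨ (u ∈ Pc y ∧ z = nb y u)) → ((u' = 0 ∧ z' = y) ∨ (u' ∈ Pc y ∧ z' = nb y u')) →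
        sqNormInt (u - u') = sqNormInt (t - t')))

include hch in
/-- **The six in-layer neighbour sites** of a frame `⟨x, t₁, t₂, U⟩ = Φ i j` of a coherent layer
are `nb x (±t₁)`, `nb x (±t₂)`, `nb x (±(t₁ − t₂))`. [folklore] -/
theorem sites_inlayer {Φ : ℤ → ℤ → ZFrame} (hval : ∀ i j, IsFrame (Pc (Φ i j).pt) (Φ i j).t₁ (Φ i j).t₂ (Φ i j).U) (hS : ∀ i j, (Φ i j).pt ∈ S) (hI : ∀ i j, Φ (i + 1) j = Istep Pc nb (Φ i j)) (hJ : ∀ i j, Φ i (j + 1) = Jstep Pc nb (Φ i j)) (i j : ℤ) {x : (EuclideanSpace ℝ (Fin 3))} {t₁ t₂ : Fin 3 → ℤ} {U : Finset (Fin 3 → ℤ)} (h : Φ i j = ⟨x, t₁, t₂, U⟩) : (Φ (i + 1) j).pt = nb x t₁ ∧ (Φ (i - 1) j).pt = nb x (-t₁) ∧ (Φ i (j + 1)).pt = nb x t₂ ∧ (Φ i (j - 1)).pt = nb x (-t₂) ∧ (Φ (i - 1) (j + 1)).pt = nb x (t₂ - t₁) ∧ (Φ (i + 1) (j - 1)).pt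 = nb x (t₁ - t₂) := by
  have hvalE : ∀ (i' j' : ℤ) (E : ZFrame), Φ i' j' = E → IsFrame (Pc E.pt) E.t₁ E.t₂ E.U := by
    intro i' j' E hE; rw [← hE]; exact hval i' j'
  have hx : x ∈ S := by have := hS i j; rw [h] at this; exact this
  have hU : IsFrame (Pc x) t₁ t₂ U := hvalE i j _ h
  -- behind along I
  rcases hm : Φ (i - 1) j with ⟨x', a, b, W⟩
  have hx' : x' ∈ S := by have := hS (i - 1) j; rw [hm] at this; exact this
  have hW : IsFrame (Pc x') a b W := hvalE _ _ _ hm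
  have hrelI : (⟨x, t₁, t₂, U⟩ : ZFrame) = Istep Pc nb ⟨x', a, b, W⟩ := by
    rw [← h, ← hm, ← hI, Int.sub_add_cancel]
  obtain ⟨-, hbackI, hvalI⟩ := back_I hch hx' hW hU hrelI
  -- behind along J
  rcases hn : Φ i (j - 1) with ⟨x'', a', b', W'⟩
  have hx'' : x'' ∈ S := by have := hS i (j - 1); rw [hn] at this; exact this
  have hW' : IsFrame (Pc x'') a' b' W' := hvalE _ _ _ hn
  have hrelJ : (⟨x, t₁, t₂, U⟩ : ZFrame) = Jstep Pc nb ⟨x'', a', b', W'⟩ := by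
    rw [← h, ← hn, ← hJ, Int.sub_add_cancel]
  obtain ⟨-, hbackJ, hvalJ⟩ := back_J hch hx'' hW' hU hrelJ
  refine ⟨by rw [hI, h]; rfl, hbackI.symm, by rw [hJ, h]; rfl, hbackJ.symm, ?_, ?_⟩
  · -- `Φ (i−1) (j+1) = J (Φ (i−1) j)`: its point is `nb x' b`, the common neighbour labelled `v = t₂ − t₁` at `x`
    obtain ⟨-, -, -, -, -, hvnb, -⟩ := Istep_spec hch hx' hW (hregI_of_valid (Pc := Pc) (nb := nb) hvalI)
    have hxe : x = nb x' a := congrArg ZFrame.pt hrelI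
    have ht₁e : t₁ = -zlab Pc nb (nb x' a) x' := congrArg ZFrame.t₁ hrelI
    have ht₂e : t₂ = zlab Pc nb (nb x' a) (nb x' b) - zlab Pc nb (nb x' a) x' := congrArg ZFrame.t₂ hrelI
    rw [hJ, hm]
    show nb x' b = nb x (t₂ - t₁)
    rw [hxe, ht₁e, ht₂e, show zlab Pc nb (nb x' a) (nb x' b) - zlab Pc nb (nb x' a) x' - -zlab Pc nb (nb x' a) x' =
      zlab Pc nb (nb x' a) (nb x' b) by abel]
    exact hvnb.symm
  · obtain ⟨-, -, -, -, -, hvnb, -⟩ := Jstep_spec hch hx'' hW' (hregJ_of_valid (Pc := Pc) (nb := nb) hvalJ)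
    have hxe : x = nb x'' b' := congrArg ZFrame.pt hrelJ
    have ht₁e : t₁ = zlab Pc nb (nb x'' b') (nb x'' a') - zlab Pc nb (nb x'' b') x'' := congrArg ZFrame.t₁ hrelJ
    have ht₂e : t₂ = -zlab Pc nb (nb x'' b') x'' := congrArg ZFrame.t₂ hrelJ
    rw [hI, hn]
    show nb x'' a' = nb x (t₁ - t₂)
    rw [hxe, ht₁e, ht₂e, show zlab Pc nb (nb x'' b') (nb x'' a') - zlab Pc nb (nb x'' b') x'' - -zlab Pc nb (nb x'' b') x'' =
      zlab Pc nb (nb x'' b') (nb x'' a') by abel]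
    exact hvnb.symm

include hch in
/-- **Upper sites, going up by `V`**: for a frame `g = Φ i j` of a coherent layer, the apex site
of `V g` is `nb x c` and the apex sites of the `V`-images of its I/J-neighbours are
`nb x (c ∓ t₁)`, `nb x (c ∓ t₂)` (sign by parity). [folklore] -/
theorem up_of_V {Φ : ℤ → ℤ → ZFrame}
    (hval : ∀ i j, IsFrame (Pc (Φ i j).pt) (Φ i j).t₁ (Φ i j).t₂ (Φ i j).U)
    (hS : ∀ i j, (Φ i j).pt ∈ S) (hI : ∀ i j, Φ (i + 1) j = Istep Pc nb (Φ i j))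
    (hJ : ∀ i j, Φ i (j + 1) = Jstep Pc nb (Φ i j)) (i j : ℤ) {x : (EuclideanSpace ℝ (Fin 3))} {t₁ t₂ : Fin 3 → ℤ}
    {U : Finset (Fin 3 → ℤ)} (h : Φ i j = ⟨x, t₁, t₂, U⟩) :
    (Vstep Pc nb (Φ i j)).pt = nb x (apexOf t₁ t₂ U) ∧
    (frameParity t₁ t₂ U = 1 → (Vstep Pc nb (Φ (i - 1) j)).pt = nb x (apexOf t₁ t₂ U - t₁) ∧
      (Vstep Pc nb (Φ i (j - 1))).pt = nb x (apexOf t₁ t₂ U - t₂)) ∧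
    (frameParity t₁ t₂ U = -1 → (Vstep Pc nb (Φ (i + 1) j)).pt = nb x (apexOf t₁ t₂ U + t₁) ∧
      (Vstep Pc nb (Φ i (j + 1))).pt = nb x (apexOf t₁ t₂ U + t₂)) := by
  have hvalE : ∀ (i' j' : ℤ) (E : ZFrame), Φ i' j' = E → IsFrame (Pc E.pt) E.t₁ E.t₂ E.U := by
    intro i' j' E hE; rw [← hE]; exact hval i' j'
  obtain ⟨hx, hU, hIg, hJg, -⟩ := nbhd hch hval hS hI hJ i j h
  have hregI := hregI_of_valid (Pc := Pc) (nb := nb) hIg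
  have hregJ := hregJ_of_valid (Pc := Pc) (nb := nb) hJg
  refine ⟨by rw [h]; rfl, fun hpar => ⟨?_, ?_⟩, fun hpar => ⟨?_, ?_⟩⟩
  · rcases hm : Φ (i - 1) j with ⟨x', a, b, W⟩
    have hx' : x' ∈ S := by have := hS (i - 1) j; rw [hm] at this; exact this
    have hW : IsFrame (Pc x') a b W := hvalE _ _ _ hm
    have hrelI : (⟨x, t₁, t₂, U⟩ : ZFrame) = Istep Pc nb ⟨x', a, b, W⟩ := by
      rw [← h, ← hm, ← hI, Int.sub_add_cancel]
    obtain ⟨-, -, hvalI⟩ := back_I hch hx' hW hU hrelI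
    have hreg := hregI_of_valid (Pc := Pc) (nb := nb) hvalI
    obtain ⟨-, -, -, -, -, -, -, -, -, -, -, -, hparI, -⟩ := Istep_spec hch hx' hW hreg
    have hparW : frameParity a b W = 1 := by rw [← hparI, ← hrelI]; exact hpar
    have hatt := (attach_I_even hch hx' hW hparW hreg).1
    rw [← hrelI] at hatt
    have hxe : x = nb x' a := congrArg ZFrame.pt hrelI
    show nb x' (apexOf a b W) = nb x (apexOf t₁ t₂ U - t₁)
    rw [hxe]; exact hatt.symm
  · rcases hn : Φ i (j - 1) with ⟨x', a, b, W⟩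
    have hx' : x' ∈ S := by have := hS i (j - 1); rw [hn] at this; exact this
    have hW : IsFrame (Pc x') a b W := hvalE _ _ _ hn
    have hrelJ : (⟨x, t₁, t₂, U⟩ : ZFrame) = Jstep Pc nb ⟨x', a, b, W⟩ := by
      rw [← h, ← hn, ← hJ, Int.sub_add_cancel]
    obtain ⟨-, -, hvalJ⟩ := back_J hch hx' hW hU hrelJ
    have hreg := hregJ_of_valid (Pc := Pc) (nb := nb) hvalJ
    obtain ⟨-, -, -, -, -, -, -, -, -, -, -, -, hparJ', -⟩ := Jstep_spec hch hx' hW hreg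
    have hparW : frameParity a b W = 1 := by rw [← hparJ', ← hrelJ]; exact hpar
    have hatt := (attach_J_even hch hx' hW hparW hreg).1
    rw [← hrelJ] at hatt
    have hxe : x = nb x' b := congrArg ZFrame.pt hrelJ
    show nb x' (apexOf a b W) = nb x (apexOf t₁ t₂ U - t₂)
    rw [hxe]; exact hatt.symm
  · rw [hI, h]; exact (attach_I_odd hch hx hU hpar hregI).1
  · rw [hJ, h]; exact (attach_J_odd hch hx hU hpar hregJ).1

include hch in
/-- **Upper sites, seen from below a layer** (`g = V⁻¹ hh`): the upper cap sites of `g` are the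
point of `hh` and its `I^{∓1}`, `J^{∓1}`-neighbours. [folklore] -/
theorem up_of_Vinv {Φ : ℤ → ℤ → ZFrame}
    (hval : ∀ i j, IsFrame (Pc (Φ i j).pt) (Φ i j).t₁ (Φ i j).t₂ (Φ i j).U)
    (hS : ∀ i j, (Φ i j).pt ∈ S) (hI : ∀ i j, Φ (i + 1) j = Istep Pc nb (Φ i j))
    (hJ : ∀ i j, Φ i (j + 1) = Jstep Pc nb (Φ i j)) (i j : ℤ) {x : (EuclideanSpace ℝ (Fin 3))} {t₁ t₂ : Fin 3 → ℤ}
    {U : Finset (Fin 3 → ℤ)} (h : VinvStep Pc nb (Φ i j) = ⟨x, t₁, t₂, U⟩) :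
    (Φ i j).pt = nb x (apexOf t₁ t₂ U) ∧
    (frameParity t₁ t₂ U = 1 → (Φ (i - 1) j).pt = nb x (apexOf t₁ t₂ U - t₁) ∧
      (Φ i (j - 1)).pt = nb x (apexOf t₁ t₂ U - t₂)) ∧
    (frameParity t₁ t₂ U = -1 → (Φ (i + 1) j).pt = nb x (apexOf t₁ t₂ U + t₁) ∧
      (Φ i (j + 1)).pt = nb x (apexOf t₁ t₂ U + t₂)) := by
  rcases hq : Φ i j with ⟨xh, ah, bh, Wh⟩
  obtain ⟨hxh, hWh, hIg, hJg, hIig, hJig, -⟩ := nbhd hch hval hS hI hJ i j hq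
  obtain ⟨e1, e2, e3, e4, -, -⟩ := sites_inlayer hch hval hS hI hJ i j hq
  rw [hq] at h
  have hxe : x = nb xh (apexOf ah bh (lowerCap (Pc xh) ah bh Wh)) := (congrArg ZFrame.pt h).symm
  have ht₁e : (VinvStep Pc nb ⟨xh, ah, bh, Wh⟩).t₁ = t₁ := congrArg ZFrame.t₁ h
  have ht₂e : (VinvStep Pc nb ⟨xh, ah, bh, Wh⟩).t₂ = t₂ := congrArg ZFrame.t₂ h
  have hUe : (VinvStep Pc nb ⟨xh, ah, bh, Wh⟩).U = U := congrArg ZFrame.U h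
  obtain ⟨-, hdS, -, hξP, hξx, hframeVi, hparVi, hbr⟩ := VinvStep_spec hch hxh hWh hIg hJg hIig hJig
  rw [← hxe] at hdS hξP hξx hframeVi hbr
  rw [ht₁e, ht₂e, hUe] at hbr hparVi hframeVi
  have hPx := pattern_cases hch hdS
  have hU : IsFrame (Pc x) t₁ t₂ U := hframeVi
  rcases hbr with ⟨hlp, hUd, hnI, hnJ, -⟩ | ⟨hlp, hUd, hnI, hnJ, -⟩
  · have hapex : apexOf t₁ t₂ U = zlab Pc nb x xh := apexOf_eq_of_form hPx hU (by rw [hUd]; simp) (Or.inl hUd)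
    rw [hapex]
    refine ⟨hξx.symm, fun _ => ⟨?_, ?_⟩, fun hpar => ?_⟩
    · rw [e2]; exact hnI.symm
    · rw [e4]; exact hnJ.symm
    · exfalso; rw [hparVi, hlp] at hpar; norm_num at hpar
  · have hapex : apexOf t₁ t₂ U = zlab Pc nb x xh := apexOf_eq_of_form hPx hU (by rw [hUd]; simp) (Or.inr hUd)
    rw [hapex]
    refine ⟨hξx.symm, fun hpar => ?_, fun _ => ⟨?_, ?_⟩⟩
    · exfalso; rw [hparVi, hlp] at hpar; norm_num at hpar
    · rw [e1]; exact hnI.symm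
    · rw [e3]; exact hnJ.symm

include hch in
/-- **Lower sites, going down by `V⁻¹`**: for a frame `g = Φ i j` of a coherent layer, the apex
site of `V⁻¹ g` is `nb x d` and the apex sites of the `V⁻¹`-images of its I/J-neighbours are
`nb x (d ± t₁)`, `nb x (d ± t₂)` (sign by the letter read below). [folklore] -/
theorem down_of_Vinv {Φ : ℤ → ℤ → ZFrame}
    (hval : ∀ i j, IsFrame (Pc (Φ i j).pt) (Φ i j).t₁ (Φ i j).t₂ (Φ i j).U)
    (hS : ∀ i j, (Φ i j).pt ∈ S) (hI : ∀ i j, Φ (i + 1) j = Istep Pc nb (Φ i j))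
    (hJ : ∀ i j, Φ i (j + 1) = Jstep Pc nb (Φ i j)) (i j : ℤ) {x : (EuclideanSpace ℝ (Fin 3))} {t₁ t₂ : Fin 3 → ℤ}
    {U : Finset (Fin 3 → ℤ)} (h : Φ i j = ⟨x, t₁, t₂, U⟩) :
    (VinvStep Pc nb (Φ i j)).pt = nb x (apexOf t₁ t₂ (lowerCap (Pc x) t₁ t₂ U)) ∧
    (lowerParity t₁ t₂ (lowerCap (Pc x) t₁ t₂ U) = 1 →
      (VinvStep Pc nb (Φ (i + 1) j)).pt = nb x (apexOf t₁ t₂ (lowerCap (Pc x) t₁ t₂ U) + t₁) ∧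
      (VinvStep Pc nb (Φ i (j + 1))).pt = nb x (apexOf t₁ t₂ (lowerCap (Pc x) t₁ t₂ U) + t₂)) ∧
    (lowerParity t₁ t₂ (lowerCap (Pc x) t₁ t₂ U) = -1 →
      (VinvStep Pc nb (Φ (i - 1) j)).pt = nb x (apexOf t₁ t₂ (lowerCap (Pc x) t₁ t₂ U) - t₁) ∧
      (VinvStep Pc nb (Φ i (j - 1))).pt = nb x (apexOf t₁ t₂ (lowerCap (Pc x) t₁ t₂ U) - t₂)) := by
  have hvalE : ∀ (i' j' : ℤ) (E : ZFrame), Φ i' j' = E → IsFrame (Pc E.pt) E.t₁ E.t₂ E.U := by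
    intro i' j' E hE; rw [← hE]; exact hval i' j'
  obtain ⟨hx, hU, hIg, hJg, -⟩ := nbhd hch hval hS hI hJ i j h
  have hregI := hregI_of_valid (Pc := Pc) (nb := nb) hIg
  have hregJ := hregJ_of_valid (Pc := Pc) (nb := nb) hJg
  refine ⟨by rw [h]; rfl, fun hlp => ⟨?_, ?_⟩, fun hlp => ⟨?_, ?_⟩⟩
  · rw [hI, h]; exact (attach_lower_I_pos hch hx hU hlp hregI).2.1
  · rw [hJ, h]; exact (attach_lower_J_pos hch hx hU hlp hregJ).2.1
  · rcases hm : Φ (i - 1) j with ⟨x', a, b, W⟩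
    have hx' : x' ∈ S := by have := hS (i - 1) j; rw [hm] at this; exact this
    have hW : IsFrame (Pc x') a b W := hvalE _ _ _ hm
    have hrelI : (⟨x, t₁, t₂, U⟩ : ZFrame) = Istep Pc nb ⟨x', a, b, W⟩ := by
      rw [← h, ← hm, ← hI, Int.sub_add_cancel]
    obtain ⟨-, -, hvalI⟩ := back_I hch hx' hW hU hrelI
    have hreg := hregI_of_valid (Pc := Pc) (nb := nb) hvalI
    have hxe : x = nb x' a := congrArg ZFrame.pt hrelI
    have hlpW : lowerParity a b (lowerCap (Pc x') a b W) = -1 := by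
      rcases lowerParity_eq_or a b (lowerCap (Pc x') a b W) with h1 | h1
      · exfalso
        have := (attach_lower_I_pos hch hx' hW h1 hreg).1
        rw [← hrelI, ← hxe] at this
        change lowerParity t₁ t₂ (lowerCap (Pc x) t₁ t₂ U) = 1 at this
        rw [hlp] at this; norm_num at this
      · exact h1
    have hatt := (attach_lower_I_neg hch hx' hW hlpW hreg).2.1
    rw [← hrelI, ← hxe] at hatt
    show nb x' (apexOf a b (lowerCap (Pc x') a b W)) = _
    exact hatt.symm
  · rcases hn : Φ i (j - 1) with ⟨x', a, b, W⟩
    have hx' : x' ∈ S := by have := hS i (j - 1); rw [hn] at this; exact this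
    have hW : IsFrame (Pc x') a b W := hvalE _ _ _ hn
    have hrelJ : (⟨x, t₁, t₂, U⟩ : ZFrame) = Jstep Pc nb ⟨x', a, b, W⟩ := by
      rw [← h, ← hn, ← hJ, Int.sub_add_cancel]
    obtain ⟨-, -, hvalJ⟩ := back_J hch hx' hW hU hrelJ
    have hreg := hregJ_of_valid (Pc := Pc) (nb := nb) hvalJ
    have hxe : x = nb x' b := congrArg ZFrame.pt hrelJ
    have hlpW : lowerParity a b (lowerCap (Pc x') a b W) = -1 := by
      rcases lowerParity_eq_or a b (lowerCap (Pc x') a b W) with h1 | h1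
      · exfalso
        have := (attach_lower_J_pos hch hx' hW h1 hreg).1
        rw [← hrelJ, ← hxe] at this
        change lowerParity t₁ t₂ (lowerCap (Pc x) t₁ t₂ U) = 1 at this
        rw [hlp] at this; norm_num at this
      · exact h1
    have hatt := (attach_lower_J_neg hch hx' hW hlpW hreg).2.1
    rw [← hrelJ, ← hxe] at hatt
    show nb x' (apexOf a b (lowerCap (Pc x') a b W)) = _
    exact hatt.symm

include hch in
/-- **Lower sites, seen from above a layer** (`g = V hh`): the lower cap sites of `g` are the
point of `hh` and its `I^{±1}`, `J^{±1}`-neighbours. [folklore] -/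
theorem down_of_V {Φ : ℤ → ℤ → ZFrame}
    (hval : ∀ i j, IsFrame (Pc (Φ i j).pt) (Φ i j).t₁ (Φ i j).t₂ (Φ i j).U)
    (hS : ∀ i j, (Φ i j).pt ∈ S) (hI : ∀ i j, Φ (i + 1) j = Istep Pc nb (Φ i j))
    (hJ : ∀ i j, Φ i (j + 1) = Jstep Pc nb (Φ i j)) (i j : ℤ) {x : (EuclideanSpace ℝ (Fin 3))} {t₁ t₂ : Fin 3 → ℤ}
    {U : Finset (Fin 3 → ℤ)} (h : Vstep Pc nb (Φ i j) = ⟨x, t₁, t₂, U⟩) :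
    (Φ i j).pt = nb x (apexOf t₁ t₂ (lowerCap (Pc x) t₁ t₂ U)) ∧
    (lowerParity t₁ t₂ (lowerCap (Pc x) t₁ t₂ U) = 1 →
      (Φ (i + 1) j).pt = nb x (apexOf t₁ t₂ (lowerCap (Pc x) t₁ t₂ U) + t₁) ∧
      (Φ i (j + 1)).pt = nb x (apexOf t₁ t₂ (lowerCap (Pc x) t₁ t₂ U) + t₂)) ∧
    (lowerParity t₁ t₂ (lowerCap (Pc x) t₁ t₂ U) = -1 →
      (Φ (i - 1) j).pt = nb x (apexOf t₁ t₂ (lowerCap (Pc x) t₁ t₂ U) - t₁) ∧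
      (Φ i (j - 1)).pt = nb x (apexOf t₁ t₂ (lowerCap (Pc x) t₁ t₂ U) - t₂)) := by
  rcases hq : Φ i j with ⟨xh, ah, bh, Wh⟩
  obtain ⟨hxh, hWh, hIg, hJg, hIig, hJig, -⟩ := nbhd hch hval hS hI hJ i j hq
  obtain ⟨e1, e2, e3, e4, -, -⟩ := sites_inlayer hch hval hS hI hJ i j hq
  rw [hq] at h
  have hxe : x = nb xh (apexOf ah bh Wh) := (congrArg ZFrame.pt h).symm
  have ht₁e : (Vstep Pc nb ⟨xh, ah, bh, Wh⟩).t₁ = t₁ := congrArg ZFrame.t₁ h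
  have ht₂e : (Vstep Pc nb ⟨xh, ah, bh, Wh⟩).t₂ = t₂ := congrArg ZFrame.t₂ h
  have hUe : (Vstep Pc nb ⟨xh, ah, bh, Wh⟩).U = U := congrArg ZFrame.U h
  obtain ⟨-, huS, -, hξP, hξx, hframeV, hlpV, hbr⟩ := Vstep_spec hch hxh hWh hIg hJg hIig hJig
  rw [← hxe] at huS hξP hξx hframeV hbr hlpV
  rw [ht₁e, ht₂e, hUe] at hbr hlpV hframeV
  have hPx := pattern_cases hch huS
  have hU : IsFrame (Pc x) t₁ t₂ U := hframeV
  have hL := isFrame_lowerCap hPx hU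
  rcases hbr with ⟨hparh, hLd, hnI, hnJ, -⟩ | ⟨hparh, hLd, hnI, hnJ, -⟩
  · have hapex : apexOf t₁ t₂ (lowerCap (Pc x) t₁ t₂ U) = zlab Pc nb x xh :=
      apexOf_eq_of_form hPx hL (by rw [hLd]; simp) (Or.inr hLd)
    rw [hapex]
    refine ⟨hξx.symm, fun _ => ⟨?_, ?_⟩, fun hlp => ?_⟩
    · rw [e1]; exact hnI.symm
    · rw [e3]; exact hnJ.symm
    · exfalso; rw [hlpV, hparh] at hlp; norm_num at hlp
  · have hapex : apexOf t₁ t₂ (lowerCap (Pc x) t₁ t₂ U) = zlab Pc nb x xh :=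
      apexOf_eq_of_form hPx hL (by rw [hLd]; simp) (Or.inl hLd)
    rw [hapex]
    refine ⟨hξx.symm, fun hlp => ?_, fun _ => ⟨?_, ?_⟩⟩
    · exfalso; rw [hlpV, hparh] at hlp; norm_num at hlp
    · rw [e2]; exact hnI.symm
    · rw [e4]; exact hnJ.symm

/-- Landing anchor of this helper file (registered on crux stmt-AtomisticToContinuum-13603 for the port of stub R1a4;
a label of the integer kissing pattern). [folklore] -/
theorem development_globale_anchor : ![-1, -1, -4] ∈ hcpInt := by decide

end Summit.AtomisticToContinuum.Crystallization.Theorems.PalmGoodLaw.Development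

end
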